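import Summits.BirchSwinnertonDyer.BirchSwinnertonDyer.Theorems.ClassRecordThreeEulerHalvesAtThreeEichlerShimuraTorsionCountK
import Summits.BirchSwinnertonDyer.BirchSwinnertonDyer.Theorems.ClassRecordThreeEulerHalvesAtThreeCartanTransportHull
import Literature.NumberTheory.Automorphic.QuaternionOrderUnitsCocompact
import Literature.Topology.FourManifolds.SurfaceGroupGenusOne
import HarnessLib

/-!
# The torsion-refined Shapiro count, part L: torsion-null lifting at division algebras ⇐ the surface-group quotient of a
# cocompact Fuchsian group (TRANSFER: Poincaré ∕ Armstrong presentation ↦ the residual of (SIGᶜ-lift)(ii))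

Helper file (route `ClassRecordThree` ∕ twin `KolyvaginRoadThree`, crux `EulerHalvesAtThree`, node `CartanOnePlaceDegreeLawAtThree`,
print residue (SIGᶜ-lift)(ii); seat bsd-idea-10 g25, lens `transfer`, `--supports stmt-BirchSwinnertonDyer-19109 --as helper`).

Part K (`EichlerShimuraLevelK.parabolicCochain_modLift_of_torsLift`) reduced the named fact
`Literature.NumberTheory.Automorphic.parabolicCochain_modLift` to ONE bespoke clause, displayed there as the hypothesis `htors`:
at a DIVISION quaternion algebra every additive `ψ : ι(O¹) → ℤ/n` killing the elements of finite order is the reduction of an additive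
`u : ι(O¹) → ℤ`.  This file splits that clause into

* §1 PURE ALGEBRA (proved): `exists_int_lift_of_surjective_to_surfaceGroup` — if a group `Γ` surjects onto the presented surface group
  `S_g = ⟨a₁,b₁,…,a_g,b_g ∣ ∏[aᵢ,bᵢ]⟩` (`Literature.Topology.FourManifolds.SurfaceGroup g`) with kernel inside the normal closure of the
  torsion of `Γ`, then every additive torsion-null `ψ : Γ → ℤ/n` lifts to an additive `u : Γ → ℤ` (factor `ψ` through `S_g`, lift on the
  `2g` free abelian generators with `SurfaceGroup.toCommGroup`, compare reductions by `PresentedGroup.ext`);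
* §2 THE TEXTBOOK INPUT (displayed inline as a hypothesis, NOT asserted): the SURFACE-GROUP QUOTIENT of a cocompact Fuchsian group —
  for a discrete `Γ ≤ SL₂(ℝ)` with a compact set meeting every orbit on `ℍ`, `Γ/⟨⟨torsion⟩⟩ ≅ S_g` (`g` = genus of `Γ∖ℍ`): Poincaré's
  presentation `⟨Aᵢ, Bᵢ, Xⱼ ∣ Xⱼ^{mⱼ}, X₁⋯X_r ∏[Aᵢ,Bᵢ]⟩` of a group of signature `(g; m₁,…,m_r)` together with "every element of finite
  order is conjugate into some ⟨Xⱼ⟩" (Katok §4.3, Thm. 3.5.2; Iwaniec Prop. 2.6 with `h = 0`), or Armstrong's theorem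
  `π₁(ℍ/Γ̄) ≅ Γ̄/⟨⟨elements with fixed points⟩⟩` plus the classification of closed orientable surfaces (`−1` is torsion, so `Γ` and `Γ̄ = Γ/{±1}`
  have the same quotient).  Two shapes: `h𝔉` for an arbitrary discrete cocompact `Γ ≤ SL₂(ℝ)` (general form) and its restriction to the
  family `Γ = ι(O¹)` of orders in division algebras (family form); `surfaceQuotient_normOneUnits_of_fuchsian` derives the family form from the
  general one with the tree's `CartanTransport.Hull.isDiscreteSubgroup_normOneUnits` (discreteness, Vignéras IV.1.1) and
  `exists_isCompact_forall_exists_mem_normOneUnits_smul_mem` (cocompactness at division algebras, Shimura §9.2);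
* §3 ASSEMBLY (proved): family form ⇒ the `htors` clause of part K verbatim (`torsLift_of_surfaceQuotient`) ⇒ `parabolicCochain_modLift`
  (`parabolicCochain_modLift_of_surfaceQuotient`, `parabolicCochain_modLift_of_fuchsianSurfaceQuotient`).

So after this file the only unproved input behind (SIGᶜ-lift)(ii) is a statement about Fuchsian groups found verbatim in the textbooks,
with no quaternion algebra, no cochain and no congruence in it.  No summit statement is proved; nothing about any curve; BSD is proved for
no curve.

## References
* S. Katok, *Fuchsian Groups*, Chicago Lectures in Mathematics (1992), §4.3 pp. 90–98 (signature `(g; m₁,…,m_r)` of a cocompact group and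
  its presentation, following Thm. 4.3.2), Thm. 3.5.2 p. 70 (conjugacy classes of maximal finite cyclic subgroups ↔ elliptic cycles) [Katok1992].
* H. Iwaniec, *Spectral Methods of Automorphic Forms*, 2nd ed., GSM 53 (2002), Prop. 2.6 (generators `Aⱼ, Bⱼ, Eⱼ, Pⱼ` and relations
  `[A₁,B₁]⋯[A_g,B_g]E₁⋯E_ℓP₁⋯P_h = 1`, `Eⱼ^{mⱼ} = 1`; signature `(g; m₁,…,m_ℓ; h)`) [Iwaniec2002].
* M. A. Armstrong, The fundamental group of the orbit space of a discontinuous group, *Proc. Cambridge Philos. Soc.* 64 (1968) 299–301,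
  doi:10.1017/s0305004100042845 [Armstrong1968].
* G. Shimura, *Introduction to the arithmetic theory of automorphic functions* (1971), §9.2 p. 246 (`Γ∖ℍ` compact for a division algebra)
  [ShimuraIATAF1971]; M.-F. Vignéras, LNM 800, Ch. IV §1 Thm. 1.1 [VignerasLNM800].
* A. Hatcher, *Algebraic Topology* (2002), §1.2 p. 51 (`π₁(M_g) = ⟨a₁,b₁,…,a_g,b_g ∣ ∏[aᵢ,bᵢ]⟩`, abelianisation `ℤ^{2g}`) [HatcherAT2002].
-/

set_option linter.dupNamespace false

noncomputable section

open scoped MatrixGroups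

namespace Summit.BirchSwinnertonDyer.BirchSwinnertonDyer.Theorems.EichlerShimuraLevelL

open Literature.NumberTheory.Automorphic Literature.Topology.FourManifolds

/-! ## §1 Pure algebra: torsion-null cochains lift through a surface-group quotient -/

/-- **LIFTING THROUGH A SURFACE-GROUP QUOTIENT.** Let `φ : Γ ↠ S_g` be a surjection onto the presented surface group whose kernel lies in
the normal closure of the torsion of `Γ`.  Then every additive `ψ : Γ → ℤ/n` vanishing on the elements of finite order is the reduction
mod `n` of an additive `u : Γ → ℤ`: `ψ` factors through `S_g`, and on `S_g` every character to `ℤ/n` lifts to `ℤ` because a homomorphism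
out of `S_g` into an abelian group is an arbitrary assignment on the `2g` generators (`SurfaceGroup.toCommGroup`; `H₁(S_g) = ℤ^{2g}` is
free). [cite: HatcherAT2002, §1.2 p. 51] -/
theorem exists_int_lift_of_surjective_to_surfaceGroup {Γ : Type*} [Group Γ] {g : ℕ}
    (φ : Γ →* SurfaceGroup g) (hφ : Function.Surjective φ)
    (hker : φ.ker ≤ Subgroup.normalClosure {γ : Γ | IsOfFinOrder γ})
    {n : ℕ} (ψ : Γ → ZMod n) (hadd : ∀ γ δ : Γ, ψ (γ * δ) = ψ γ + ψ δ)
    (hfin : ∀ γ : Γ, IsOfFinOrder γ → ψ γ = 0) :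
    ∃ u : Γ → ℤ, (∀ γ δ : Γ, u (γ * δ) = u γ + u δ) ∧ ∀ γ : Γ, (u γ : ZMod n) = ψ γ := by
  classical
  -- `ψ` as a homomorphism to `Multiplicative (ℤ/n)`
  let ψh : Γ →* Multiplicative (ZMod n) :=
    MonoidHom.mk' (fun γ => Multiplicative.ofAdd (ψ γ)) fun a b => by
      change Multiplicative.ofAdd (ψ (a * b)) = Multiplicative.ofAdd (ψ a) * Multiplicative.ofAdd (ψ b)
      rw [hadd, ofAdd_add]
  have hψh : ∀ γ, ψh γ = Multiplicative.ofAdd (ψ γ) := fun γ => rfl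
  -- `ker φ ≤ ⟨⟨torsion⟩⟩ ≤ ker ψ`
  have hkerψ : φ.ker ≤ ψh.ker := by
    refine hker.trans (Subgroup.normalClosure_le_normal ?_)
    intro γ hγ
    rw [SetLike.mem_coe, MonoidHom.mem_ker, hψh, hfin γ hγ, ofAdd_zero]
  -- factor `ψ` through the surface group
  let ψ' : SurfaceGroup g →* Multiplicative (ZMod n) :=
    φ.liftOfRightInverse (Function.surjInv hφ) (Function.rightInverse_surjInv hφ) ⟨ψh, hkerψ⟩
  have hψ' : ∀ γ, ψ' (φ γ) = ψh γ := fun γ =>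
    φ.liftOfRightInverse_comp_apply (Function.surjInv hφ) (Function.rightInverse_surjInv hφ) ⟨ψh, hkerψ⟩ γ
  -- an integral lift on the generators extends to `S_g` (abelian target)
  let f : surfaceGen g → Multiplicative ℤ := fun x =>
    Multiplicative.ofAdd (ZMod.cast (Multiplicative.toAdd (ψ' (PresentedGroup.of x))) : ℤ)
  let ulift : SurfaceGroup g →* Multiplicative ℤ := SurfaceGroup.toCommGroup f
  have hulift : ∀ x, ulift (PresentedGroup.of x) = f x := fun x => SurfaceGroup.toCommGroup_of f x
  -- reduction mod `n`
  let red : Multiplicative ℤ →* Multiplicative (ZMod n) :=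
    MonoidHom.mk' (fun z => Multiplicative.ofAdd ((Multiplicative.toAdd z : ℤ) : ZMod n)) fun a b => by
      change Multiplicative.ofAdd ((Multiplicative.toAdd (a * b) : ℤ) : ZMod n) =
        Multiplicative.ofAdd ((Multiplicative.toAdd a : ℤ) : ZMod n) * Multiplicative.ofAdd ((Multiplicative.toAdd b : ℤ) : ZMod n)
      rw [toAdd_mul, Int.cast_add, ofAdd_add]
  have hred : ∀ z, red z = Multiplicative.ofAdd ((Multiplicative.toAdd z : ℤ) : ZMod n) := fun z => rfl
  -- the reduction of the lift IS `ψ'` (they agree on the generators)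
  have hcomp : red.comp ulift = ψ' := by
    refine PresentedGroup.ext fun x => ?_
    rw [MonoidHom.comp_apply, hulift, hred]
    change Multiplicative.ofAdd
        (((ZMod.cast (Multiplicative.toAdd (ψ' (PresentedGroup.of x))) : ℤ) : ZMod n)) = ψ' (PresentedGroup.of x)
    rw [ZMod.intCast_zmod_cast, ofAdd_toAdd]
  refine ⟨fun γ => Multiplicative.toAdd (ulift (φ γ)), fun γ δ => ?_, fun γ => ?_⟩
  · change Multiplicative.toAdd (ulift (φ (γ * δ))) = Multiplicative.toAdd (ulift (φ γ)) + Multiplicative.toAdd (ulift (φ δ))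
    rw [map_mul, map_mul, toAdd_mul]
  have h1 : red (ulift (φ γ)) = ψh γ := by rw [← MonoidHom.comp_apply, hcomp, hψ']
  rw [hred, hψh] at h1
  exact Multiplicative.ofAdd.injective h1

/-- The same with the kernel EQUAL to the normal closure of the torsion (the form in which the surface-group quotient is stated).
[cite: HatcherAT2002, §1.2 p. 51] -/
theorem exists_int_lift_of_surjective_to_surfaceGroup' {Γ : Type*} [Group Γ] {g : ℕ}
    (φ : Γ →* SurfaceGroup g) (hφ : Function.Surjective φ)
    (hker : φ.ker = Subgroup.normalClosure {γ : Γ | IsOfFinOrder γ})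
    {n : ℕ} (ψ : Γ → ZMod n) (hadd : ∀ γ δ : Γ, ψ (γ * δ) = ψ γ + ψ δ)
    (hfin : ∀ γ : Γ, IsOfFinOrder γ → ψ γ = 0) :
    ∃ u : Γ → ℤ, (∀ γ δ : Γ, u (γ * δ) = u γ + u δ) ∧ ∀ γ : Γ, (u γ : ZMod n) = ψ γ :=
  exists_int_lift_of_surjective_to_surfaceGroup φ hφ hker.le ψ hadd hfin

/-! ## §2 The textbook input: the surface-group quotient of a cocompact Fuchsian group

General form (`h𝔉` below): for every subgroup `Γ ≤ GL₂(ℝ)` of determinant-one matrices which is discrete (`IsDiscreteSubgroup`, Iwaniec's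
norm-ball form) and cocompact on `ℍ` (a compact set meets every orbit) there are `g : ℕ` and a SURJECTION `φ : Γ ↠ S_g` onto the surface
group of genus `g` whose kernel is exactly the normal closure of the elements of finite order.  Family form: the same for the groups
`Γ = ι(O¹)` of orders `O` in quaternion DIVISION algebras over `ℚ` (discrete by Vignéras IV.1.1, cocompact by Shimura §9.2).  Both are
displayed inline as hypotheses; nothing is asserted. -/

/-- **FAMILY FORM ⇐ GENERAL FORM**: `ι(O¹)` consists of determinant-one matrices (definition of `normOneUnits`), is discrete
(`CartanTransport.Hull.isDiscreteSubgroup_normOneUnits`) and, `B` being a division algebra, cocompact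
(`exists_isCompact_forall_exists_mem_normOneUnits_smul_mem`). [cite: ShimuraIATAF1971, §9.2 p. 246] [cite: VignerasLNM800, Ch. IV §1 Thm. 1.1] -/
theorem surfaceQuotient_normOneUnits_of_fuchsian
    (h𝔉 : ∀ (Γ : Subgroup (GL (Fin 2) ℝ)), (∀ γ ∈ Γ, Matrix.GeneralLinearGroup.det γ = 1) → IsDiscreteSubgroup Γ →
      (∃ K : Set UpperHalfPlane, IsCompact K ∧ ∀ z : UpperHalfPlane, ∃ γ ∈ Γ, γ • z ∈ K) →
      ∃ (g : ℕ) (φ : Γ →* SurfaceGroup g), Function.Surjective φ ∧ φ.ker = Subgroup.normalClosure {γ : Γ | IsOfFinOrder γ})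
    (B : Type) [Ring B] [Algebra ℚ B] [IsQuaternionAlgebra ℚ B] (O : Submodule ℤ B) (hO : Brandt.IsOrder B O)
    (ι : B →ₐ[ℚ] Matrix (Fin 2) (Fin 2) ℝ) (hdiv : ∀ x : B, x ≠ 0 → IsUnit x) :
    ∃ (g : ℕ) (φ : normOneUnits ι hO →* SurfaceGroup g),
      Function.Surjective φ ∧ φ.ker = Subgroup.normalClosure {γ : normOneUnits ι hO | IsOfFinOrder γ} :=
  h𝔉 (normOneUnits ι hO) (fun _ hγ => hγ.2.2) (CartanTransport.Hull.isDiscreteSubgroup_normOneUnits ι hO)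
    (exists_isCompact_forall_exists_mem_normOneUnits_smul_mem B O hO ι hdiv)

/-! ## §3 Assembly: the `htors` clause of part K, and (SIGᶜ-lift)(ii) -/

/-- **TORSION-NULL LIFTING AT DIVISION ALGEBRAS ⇐ THE SURFACE-GROUP QUOTIENT (family form)** — the hypothesis `htors` of
`EichlerShimuraLevelK.parabolicCochain_modLift_of_torsLift`, verbatim, from §1. [cite: HatcherAT2002, §1.2 p. 51]
[cite: ShimuraIATAF1971, §9.2 p. 246] -/
theorem torsLift_of_surfaceQuotient
    (hsurf : ∀ (B : Type) [Ring B] [Algebra ℚ B] [IsQuaternionAlgebra ℚ B] (O : Submodule ℤ B) (hO : Brandt.IsOrder B O)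
      (ι : B →ₐ[ℚ] Matrix (Fin 2) (Fin 2) ℝ), Function.Injective ι → (∀ x : B, x ≠ 0 → IsUnit x) →
      ∃ (g : ℕ) (φ : normOneUnits ι hO →* SurfaceGroup g),
        Function.Surjective φ ∧ φ.ker = Subgroup.normalClosure {γ : normOneUnits ι hO | IsOfFinOrder γ})
    (B : Type) [Ring B] [Algebra ℚ B] [IsQuaternionAlgebra ℚ B] (O : Submodule ℤ B) (hO : Brandt.IsOrder B O)
    (ι : B →ₐ[ℚ] Matrix (Fin 2) (Fin 2) ℝ) (hι : Function.Injective ι) (hdiv : ∀ x : B, x ≠ 0 → IsUnit x)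
    (n : ℕ) (_hn : n ≠ 0) (ψ : normOneUnits ι hO → ZMod n)
    (hadd : ∀ γ δ : normOneUnits ι hO, ψ (γ * δ) = ψ γ + ψ δ)
    (hfin : ∀ γ : normOneUnits ι hO, IsOfFinOrder γ → ψ γ = 0) :
    ∃ u : normOneUnits ι hO → ℤ,
      (∀ γ δ : normOneUnits ι hO, u (γ * δ) = u γ + u δ) ∧ ∀ γ : normOneUnits ι hO, (u γ : ZMod n) = ψ γ := by
  obtain ⟨g, φ, hφ, hker⟩ := hsurf B O hO ι hι hdiv
  exact exists_int_lift_of_surjective_to_surfaceGroup' φ hφ hker ψ hadd hfin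

/-- **(SIGᶜ-lift)(ii) ⇐ THE SURFACE-GROUP QUOTIENT (family form)**: `torsLift_of_surfaceQuotient` fed into part K's
`parabolicCochain_modLift_of_torsLift`. [cite: ShimuraIATAF1971, §8.2 (8.2.6), §9.2 p. 246] [cite: HatcherAT2002, §1.2 p. 51] -/
theorem parabolicCochain_modLift_of_surfaceQuotient
    (hsurf : ∀ (B : Type) [Ring B] [Algebra ℚ B] [IsQuaternionAlgebra ℚ B] (O : Submodule ℤ B) (hO : Brandt.IsOrder B O)
      (ι : B →ₐ[ℚ] Matrix (Fin 2) (Fin 2) ℝ), Function.Injective ι → (∀ x : B, x ≠ 0 → IsUnit x) →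
      ∃ (g : ℕ) (φ : normOneUnits ι hO →* SurfaceGroup g),
        Function.Surjective φ ∧ φ.ker = Subgroup.normalClosure {γ : normOneUnits ι hO | IsOfFinOrder γ}) :
    parabolicCochain_modLift :=
  EichlerShimuraLevelK.parabolicCochain_modLift_of_torsLift fun B _ _ _ O hO ι hι hdiv n hn ψ hadd hfin =>
    torsLift_of_surfaceQuotient hsurf B O hO ι hι hdiv n hn ψ hadd hfin

/-- **(SIGᶜ-lift)(ii) ⇐ THE SURFACE-GROUP QUOTIENT OF A COCOMPACT FUCHSIAN GROUP (general form)** — Poincaré's presentation of a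
group of signature `(g; m₁,…,m_r)` ∕ Armstrong's theorem, displayed as the hypothesis `h𝔉`. [cite: Katok1992, §4.3 pp. 90–98 and Thm. 3.5.2]
[cite: Iwaniec2002, Prop. 2.6] [cite: Armstrong1968, Theorem] [cite: ShimuraIATAF1971, §9.2 p. 246] -/
theorem parabolicCochain_modLift_of_fuchsianSurfaceQuotient
    (h𝔉 : ∀ (Γ : Subgroup (GL (Fin 2) ℝ)), (∀ γ ∈ Γ, Matrix.GeneralLinearGroup.det γ = 1) → IsDiscreteSubgroup Γ →
      (∃ K : Set UpperHalfPlane, IsCompact K ∧ ∀ z : UpperHalfPlane, ∃ γ ∈ Γ, γ • z ∈ K) →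
      ∃ (g : ℕ) (φ : Γ →* SurfaceGroup g), Function.Surjective φ ∧ φ.ker = Subgroup.normalClosure {γ : Γ | IsOfFinOrder γ}) :
    parabolicCochain_modLift :=
  parabolicCochain_modLift_of_surfaceQuotient fun B _ _ _ O hO ι _ hdiv =>
    surfaceQuotient_normOneUnits_of_fuchsian h𝔉 B O hO ι hdiv

end Summit.BirchSwinnertonDyer.BirchSwinnertonDyer.Theorems.EichlerShimuraLevelL

end
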